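import Mathlib
import HarnessLib
import Summits.Ventures.LatticeQCDFlow.Exactness.NCMCGeneralSpaceReplicaPooledJarzynski
import Summits.Ventures.LatticeQCDFlow.Exactness.NCMCGeneralSpaceRestartChainReweightedCLT

/-!
# The reweighting lane over `R` INDEPENDENT streams of correlated launches, POOLED: `√(R n) (R_{R,n} − Z₁⁻¹∫ f dν₁) ⇒ N(0, σ²_c/(Z₁/Z₀)²)` from EVERY family of launch configurations

HONEST FRAMING: exact (Metropolis-corrected) sampling algorithms for lattice gauge theory;
figures of merit are autocorrelation/cost numbers at stated couplings and volumes; no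
continuum-physics claim.

Venture `LatticeQCDFlow` (cell pub-lqcd), topic `Exactness`; FANOUT row 13 (`eng-snf`, GEN-23).
NEW WORK of the cell, not a published result; no definition is introduced; nothing is cited as a
fact.  GEN-22's `NCMCGeneralSpaceRestartChainReweightedCLT` typed `estimators.reweight` along ONE
stream of correlated launches: `√n (R_n − μ_f) ⇒ N(0, σ²_c/(Z₁/Z₀)²)`, `R_n = Σ e^{−W_i} f(end_i)/Σ e^{−W_i}`,
`c = e^{−W}(f∘e − μ_f)`, `μ_f = Z₁⁻¹∫ f dν₁`.  With `R` independent streams the engine pools numerator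
and denominator: `R_{R,n} = Σ_r Σ_i e^{−W(ω^r_i)} f(e ω^r_i) / Σ_r Σ_i e^{−W(ω^r_i)}`.  GEN-23's pooled
CLT for bounded record observables along independent restart chains
(`CrooksPair.tendstoInDistribution_pooledSum_restartChains`), the pooled strong law of the weights
(`CrooksPair.tendsto_pooledMeanWeight_ae_restartChains`) and GEN-22's ratio identity / centring
`E_F c = 0` give the pooled statement by Slutsky, exactly as along one stream.

## Content

* **`CrooksPair.tendstoInDistribution_sqrt_mul_pooledReweighted_sub_restartChains`** + `…_everyStart`.

NOT CLAIMED: dependent streams; unbounded `f` or work; a consistent estimator of `σ²_c` for the pooled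
statistic (the one-stream plug-in Γ route of GEN-22's `…ReweightedGammaCoverage` applies verbatim;
not re-typed); anything numerical.
-/

namespace Summit.Ventures.LatticeQCDFlow.Exactness.GeneralNCMC

open MeasureTheory ProbabilityTheory Set Filter Finset
open scoped ENNReal NNReal Topology

variable {Ω E : Type*} [MeasurableSpace Ω] [MeasurableSpace E]

namespace CrooksPair

variable {ν₀ ν₁ : Measure Ω} [IsFiniteMeasure ν₀] [IsFiniteMeasure ν₁] {κF κR : Kernel Ω E}
  [IsMarkovKernel κF] [IsMarkovKernel κR] {s e : E → Ω} {W : E → ℝ}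
  {ι : Type*} [Fintype ι] [Nonempty ι]

/-- **THE POOLED REWEIGHTING LANE'S CLT FROM EVERY FAMILY OF INITIAL RECORD LAWS.**  Crooks pair between
finite weights with `Z₀ ≠ 0 ≠ Z₁`; `K` Markov, `ν₀`-invariant, `m ≤ K(z, ·)` for all `z` (`m` finite,
`m(Ω) ≠ 0`); `−B ≤ W`; `|f| ≤ C_f` measurable; `R = card ι` INDEPENDENT streams from ANY record laws
`μ r`.  For every `Y` with law `N(0, σ²_c/(Z₁/Z₀)²)`, `σ²_c` the Green–Kubo variance of
`c = e^{−W}(f∘e − μ_f)` along `R = (κF ∘ₖ K).comap s`: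
`√(R n) (Σ_r Σ_{i<n} e^{−W(ω^r_i)} f(e ω^r_i) / Σ_r Σ_{i<n} e^{−W(ω^r_i)} − μ_f) ⇒ Y`. -/
theorem tendstoInDistribution_sqrt_mul_pooledReweighted_sub_restartChains (K : Kernel Ω Ω)
    [IsMarkovKernel K] (h0 : ν₀ univ ≠ 0) (h1 : ν₁ univ ≠ 0) (hK : Kernel.Invariant K ν₀)
    (h : CrooksPair ν₀ ν₁ κF κR s e W) {m : Measure Ω} [IsFiniteMeasure m] (hm0 : m univ ≠ 0)
    (hmin : ∀ z, m ≤ K z) {B : ℝ} (hB : ∀ ω, -B ≤ W ω) {f : Ω → ℝ} (hfm : Measurable f) {Cf : ℝ}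
    (hCf : ∀ y, |f y| ≤ Cf) (μ : ι → Measure E) [∀ r, IsProbabilityMeasure (μ r)]
    {Ω' : Type*} [MeasurableSpace Ω'] {P' : Measure Ω'} [IsProbabilityMeasure P'] {Y : Ω' → ℝ}
    (hY : HasLaw Y (gaussianReal 0 (Real.toNNReal
      ((Scoring.autocov ((κF ∘ₖ K).comap s h.measurable_s) (fwdPathLaw ν₀ κF)
          (fun ω => Real.exp (-W ω) * (f (e ω) - ((ν₁ univ)⁻¹).toReal * ∫ y, f y ∂ν₁)
            - ∫ z, Real.exp (-W z) * (f (e z) - ((ν₁ univ)⁻¹).toReal * ∫ y, f y ∂ν₁)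
              ∂(fwdPathLaw ν₀ κF)) 0
        + 2 * ∑' t, Scoring.autocov ((κF ∘ₖ K).comap s h.measurable_s) (fwdPathLaw ν₀ κF)
          (fun ω => Real.exp (-W ω) * (f (e ω) - ((ν₁ univ)⁻¹).toReal * ∫ y, f y ∂ν₁)
            - ∫ z, Real.exp (-W z) * (f (e z) - ((ν₁ univ)⁻¹).toReal * ∫ y, f y ∂ν₁)
              ∂(fwdPathLaw ν₀ κF)) (t + 1))
        / ((ν₀ univ)⁻¹ * ν₁ univ).toReal ^ 2))) P')
    [∀ r, IsProbabilityMeasure (Kernel.trajMeasure (X := fun _ : ℕ => E) (μ r)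
        (fun n : ℕ => ((κF ∘ₖ K).comap s h.measurable_s).comap
          (fun hh : (j : ↥(Finset.Iic n)) → E => hh ⟨n, Finset.mem_Iic.2 le_rfl⟩)
          (measurable_pi_apply _)))] :
    TendstoInDistribution (fun (n : ℕ) (ω : ι → ℕ → E) =>
        Real.sqrt ((Fintype.card ι : ℝ) * n)
          * ((∑ r, ∑ i ∈ range n, Real.exp (-W (ω r i)) * f (e (ω r i)))
            / (∑ r, ∑ i ∈ range n, Real.exp (-W (ω r i))) - ((ν₁ univ)⁻¹).toReal * ∫ y, f y ∂ν₁))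
      atTop Y (fun _ => Measure.pi fun r => Kernel.trajMeasure (X := fun _ : ℕ => E) (μ r)
        (fun n : ℕ => ((κF ∘ₖ K).comap s h.measurable_s).comap
          (fun hh : (j : ↥(Finset.Iic n)) → E => hh ⟨n, Finset.mem_Iic.2 le_rfl⟩)
          (measurable_pi_apply _))) P' := by
  haveI := isProbabilityMeasure_fwdPathLaw ν₀ h0 κF
  haveI := isProbabilityMeasure_normalised_bind_kernel κF hm0
  set θ : ℝ := ((ν₀ univ)⁻¹ * ν₁ univ).toReal with hθdef
  set μf : ℝ := ((ν₁ univ)⁻¹).toReal * ∫ y, f y ∂ν₁ with hμf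
  have hθ : 0 < θ :=
    ENNReal.toReal_pos (mul_ne_zero (ENNReal.inv_ne_zero.2 (measure_ne_top ν₀ univ)) h1)
      (ENNReal.mul_ne_top (ENNReal.inv_ne_top.2 h0) (measure_ne_top ν₁ univ))
  have hCf0 : 0 ≤ Cf := (abs_nonneg _).trans (hCf (s (Classical.choice
    (nonempty_of_isProbabilityMeasure (fwdPathLaw ν₀ κF)))))
  -- the centred numerator observable and its bound
  set c : E → ℝ := fun ω => Real.exp (-W ω) * (f (e ω) - μf) with hc
  have hcm : Measurable c :=
    (Real.measurable_exp.comp h.measurable_W.neg).mul ((hfm.comp h.measurable_e).sub measurable_const)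
  have hμfb : |μf| ≤ Cf := by
    rw [hμf, abs_mul, ENNReal.toReal_inv, abs_inv, abs_of_nonneg ENNReal.toReal_nonneg]
    rcases eq_or_ne (ν₁ univ).toReal 0 with hz | hz
    · rw [hz, inv_zero, zero_mul]; exact hCf0
    · rw [inv_mul_le_iff₀ (lt_of_le_of_ne ENNReal.toReal_nonneg (Ne.symm hz)), ← Real.norm_eq_abs]
      calc ‖∫ y, f y ∂ν₁‖ ≤ Cf * ν₁.real univ :=
            norm_integral_le_of_norm_le_const (Eventually.of_forall fun y => by
              rw [Real.norm_eq_abs]; exact hCf y)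
        _ = (ν₁ univ).toReal * Cf := by rw [measureReal_def, mul_comm]
  have hcb : ∀ ω, |c ω| ≤ Real.exp B * (2 * Cf) := fun ω => by
    rw [hc]
    dsimp only
    rw [abs_mul, abs_of_pos (Real.exp_pos _)]
    refine mul_le_mul (Real.exp_le_exp.2 (by linarith [hB ω])) ?_ (abs_nonneg _) (Real.exp_pos _).le
    calc |f (e ω) - μf| ≤ |f (e ω)| + |μf| := abs_sub _ _
      _ ≤ Cf + Cf := add_le_add (hCf _) hμfb
      _ = 2 * Cf := by ring
  -- `E_F c = 0`
  have hc0 : ∫ ω, c ω ∂(fwdPathLaw ν₀ κF) = 0 := by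
    have key := h.integral_exp_neg_work_mul_comp_end (f := fun y => f y - μf)
      (hfm.sub measurable_const).aestronglyMeasurable
    have hint : ∫ y, (f y - μf) ∂ν₁ = ∫ y, f y ∂ν₁ - ν₁.real univ * μf := by
      rw [integral_sub (Scoring.integrable_of_bounded ν₁ hfm hCf) (integrable_const _),
        integral_const, smul_eq_mul]
    rw [hc]
    dsimp only
    rw [key, hint, hμf, measureReal_def]
    simp only [ENNReal.toReal_inv]
    rcases eq_or_ne (ν₁ univ).toReal 0 with hz | hz
    · have : ∫ y, f y ∂ν₁ = 0 := by
        have hν : ν₁ = 0 := by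
          rw [← Measure.measure_univ_eq_zero]
          exact (ENNReal.toReal_eq_zero_iff _).1 hz |>.resolve_right (measure_ne_top _ _)
        rw [hν, integral_zero_measure]
      rw [this, hz]; ring
    · field_simp
      ring
  -- the limit variable `θ · Y ~ N(0, σ²_c)` (GEN-22's clipping argument)
  have hYX : HasLaw (fun ω' => θ * Y ω') (gaussianReal 0 (Real.toNNReal
      (Scoring.autocov ((κF ∘ₖ K).comap s h.measurable_s) (fwdPathLaw ν₀ κF)
          (fun ω => c ω - ∫ z, c z ∂(fwdPathLaw ν₀ κF)) 0
        + 2 * ∑' t, Scoring.autocov ((κF ∘ₖ K).comap s h.measurable_s) (fwdPathLaw ν₀ κF)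
          (fun ω => c ω - ∫ z, c z ∂(fwdPathLaw ν₀ κF)) (t + 1)))) P' := by
    set V : ℝ := Scoring.autocov ((κF ∘ₖ K).comap s h.measurable_s) (fwdPathLaw ν₀ κF)
          (fun ω => c ω - ∫ z, c z ∂(fwdPathLaw ν₀ κF)) 0
        + 2 * ∑' t, Scoring.autocov ((κF ∘ₖ K).comap s h.measurable_s) (fwdPathLaw ν₀ κF)
          (fun ω => c ω - ∫ z, c z ∂(fwdPathLaw ν₀ κF)) (t + 1) with hV
    have hg := gaussianReal_const_mul hY θ
    rw [mul_zero] at hg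
    have hnn : NNReal.mk (θ ^ 2) (sq_nonneg _) * (V / θ ^ 2).toNNReal = V.toNNReal := by
      rw [show V = θ ^ 2 * (V / θ ^ 2) by field_simp, Real.toNNReal_mul (sq_nonneg _)]
      rw [show θ ^ 2 * (V / θ ^ 2) = V by field_simp]
      congr 1
      apply NNReal.eq
      rw [NNReal.coe_mk, Real.coe_toNNReal _ (sq_nonneg _)]
    rw [hnn] at hg
    exact hg
  -- the pooled numerator CLT (GEN-23 R4 §1) and the pooled strong law of the weights (R4 §2)
  have hX := h.tendstoInDistribution_pooledSum_restartChains K h0 hK hm0 hmin hcm hcb μ hYX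
  simp_rw [hc0, sub_zero] at hX
  have hmean := h.tendsto_pooledMeanWeight_ae_restartChains K h0 hK hm0 hmin μ
  set P := Measure.pi fun r => Kernel.trajMeasure (X := fun _ : ℕ => E) (μ r)
    (fun n : ℕ => ((κF ∘ₖ K).comap s h.measurable_s).comap
      (fun hh : (j : ↥(Finset.Iic n)) → E => hh ⟨n, Finset.mem_Iic.2 le_rfl⟩)
      (measurable_pi_apply _)) with hP
  have hwm : Measurable fun ε => Real.exp (-W ε) := Real.measurable_exp.comp h.measurable_W.neg
  have hBm : ∀ n : ℕ, Measurable fun ω : ι → ℕ → E =>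
      ((∑ r, ∑ i ∈ range n, Real.exp (-W (ω r i))) / ((Fintype.card ι : ℝ) * n))⁻¹ := fun n =>
    ((Finset.measurable_sum _ fun r _ => Finset.measurable_sum _ fun i _ =>
      hwm.comp ((measurable_pi_apply i).comp (measurable_pi_apply r))).div_const _).inv
  have hBc : TendstoInMeasure P (fun (n : ℕ) (ω : ι → ℕ → E) =>
      ((∑ r, ∑ i ∈ range n, Real.exp (-W (ω r i))) / ((Fintype.card ι : ℝ) * n))⁻¹)
      atTop (fun _ => θ⁻¹) := by
    refine tendstoInMeasure_of_tendsto_ae (fun n => (hBm n).aestronglyMeasurable) ?_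
    filter_upwards [hmean] with ω hω
    exact hω.inv₀ hθ.ne'
  -- Slutsky
  have hXB := hX.continuous_comp_prodMk_of_tendstoInMeasure_const
    (g := fun p : ℝ × ℝ => p.1 * p.2) (by fun_prop) hBc (fun n => (hBm n).aemeasurable)
  refine hXB.congr (fun n => Eventually.of_forall fun ω => ?_) (Eventually.of_forall fun ω' => ?_)
  · dsimp only
    rcases Nat.eq_zero_or_pos n with hn | hn
    · subst hn; simp
    · have hR : (0 : ℝ) < Fintype.card ι := by exact_mod_cast Fintype.card_pos
      have hn' : (0 : ℝ) < (Fintype.card ι : ℝ) * n := by positivity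
      have hT : 0 < ∑ r, ∑ i ∈ range n, Real.exp (-W (ω r i)) :=
        Finset.sum_pos (fun r _ => Finset.sum_pos (fun i _ => Real.exp_pos _)
          (Finset.nonempty_range_iff.2 hn.ne')) Finset.univ_nonempty
      have hsum : ∑ r, ∑ i ∈ range n, c (ω r i)
          = ∑ r, ∑ i ∈ range n, Real.exp (-W (ω r i)) * f (e (ω r i))
            - μf * ∑ r, ∑ i ∈ range n, Real.exp (-W (ω r i)) := by
        rw [Finset.mul_sum, ← Finset.sum_sub_distrib]
        refine Finset.sum_congr rfl fun r _ => ?_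
        rw [Finset.mul_sum, ← Finset.sum_sub_distrib]
        refine Finset.sum_congr rfl fun i _ => ?_
        rw [hc]
        dsimp only
        ring
      rw [hsum]
      exact (ratio_identity (Real.mul_self_sqrt hn'.le) (Real.sqrt_pos.2 hn').ne' hT.ne').symm
  · dsimp only
    rw [mul_comm θ (Y ω'), mul_assoc, mul_inv_cancel₀ hθ.ne', mul_one]

/-- **THE POOLED REWEIGHTING LANE FROM EVERY FAMILY OF LAUNCH CONFIGURATIONS** (replica `r` first
launched from ANY configuration `x r`). -/
theorem tendstoInDistribution_sqrt_mul_pooledReweighted_sub_restartChains_everyStart (K : Kernel Ω Ω)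
    [IsMarkovKernel K] (h0 : ν₀ univ ≠ 0) (h1 : ν₁ univ ≠ 0) (hK : Kernel.Invariant K ν₀)
    (h : CrooksPair ν₀ ν₁ κF κR s e W) {m : Measure Ω} [IsFiniteMeasure m] (hm0 : m univ ≠ 0)
    (hmin : ∀ z, m ≤ K z) {B : ℝ} (hB : ∀ ω, -B ≤ W ω) {f : Ω → ℝ} (hfm : Measurable f) {Cf : ℝ}
    (hCf : ∀ y, |f y| ≤ Cf) (x : ι → Ω)
    {Ω' : Type*} [MeasurableSpace Ω'] {P' : Measure Ω'} [IsProbabilityMeasure P'] {Y : Ω' → ℝ}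
    (hY : HasLaw Y (gaussianReal 0 (Real.toNNReal
      ((Scoring.autocov ((κF ∘ₖ K).comap s h.measurable_s) (fwdPathLaw ν₀ κF)
          (fun ω => Real.exp (-W ω) * (f (e ω) - ((ν₁ univ)⁻¹).toReal * ∫ y, f y ∂ν₁)
            - ∫ z, Real.exp (-W z) * (f (e z) - ((ν₁ univ)⁻¹).toReal * ∫ y, f y ∂ν₁)
              ∂(fwdPathLaw ν₀ κF)) 0
        + 2 * ∑' t, Scoring.autocov ((κF ∘ₖ K).comap s h.measurable_s) (fwdPathLaw ν₀ κF)
          (fun ω => Real.exp (-W ω) * (f (e ω) - ((ν₁ univ)⁻¹).toReal * ∫ y, f y ∂ν₁)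
            - ∫ z, Real.exp (-W z) * (f (e z) - ((ν₁ univ)⁻¹).toReal * ∫ y, f y ∂ν₁)
              ∂(fwdPathLaw ν₀ κF)) (t + 1))
        / ((ν₀ univ)⁻¹ * ν₁ univ).toReal ^ 2))) P')
    [∀ r, IsProbabilityMeasure (Kernel.trajMeasure (X := fun _ : ℕ => E) (κF (x r))
        (fun n : ℕ => ((κF ∘ₖ K).comap s h.measurable_s).comap
          (fun hh : (j : ↥(Finset.Iic n)) → E => hh ⟨n, Finset.mem_Iic.2 le_rfl⟩)
          (measurable_pi_apply _)))] :
    TendstoInDistribution (fun (n : ℕ) (ω : ι → ℕ → E) =>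
        Real.sqrt ((Fintype.card ι : ℝ) * n)
          * ((∑ r, ∑ i ∈ range n, Real.exp (-W (ω r i)) * f (e (ω r i)))
            / (∑ r, ∑ i ∈ range n, Real.exp (-W (ω r i))) - ((ν₁ univ)⁻¹).toReal * ∫ y, f y ∂ν₁))
      atTop Y (fun _ => Measure.pi fun r => Kernel.trajMeasure (X := fun _ : ℕ => E) (κF (x r))
        (fun n : ℕ => ((κF ∘ₖ K).comap s h.measurable_s).comap
          (fun hh : (j : ↥(Finset.Iic n)) → E => hh ⟨n, Finset.mem_Iic.2 le_rfl⟩)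
          (measurable_pi_apply _))) P' :=
  h.tendstoInDistribution_sqrt_mul_pooledReweighted_sub_restartChains K h0 h1 hK hm0 hmin hB hfm hCf
    (fun r => κF (x r)) hY

end CrooksPair

end Summit.Ventures.LatticeQCDFlow.Exactness.GeneralNCMC
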